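import Summits.QuantumFields.QCD.Theorems.RobustYangMillsHandover.Negative.GapClauses
import Summits.QuantumFields.QCD.Theorems.HeatSlicedQuarksRobustYangMillsHandoverSplit

/-!
# Strategy census S13 — kernel-checked companion (crux `stmt-QuantumFields-8892`,
# `HeatSlicedQuarks.RobustYangMillsHandover := ContinuumQCDExists → QCD`)

Independent census family `s` (strategist seat `cstrat-stmt-QuantumFields-8892-s13`, 2026-08-17).
Everything here is pure logic over the tree's definitions and LANDED theorems
(`Negative/GapClauses`, `Negative/ChiralityObstruction`, `…RobustYangMillsHandoverSplit`); no `sorry`,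
nothing asserts a Theses decl except under hypotheses.

* §1 SLOT MINIMALITY — the crux is the weakest possible filler of its slot in `closes`
  (`closes … (h5 : RobustYangMillsHandover) := h5 (h4g …)`): any `C'` with `C' → X₀ → QCD` already
  implies the crux (`slot_minimal`), so "re-type the crux to something strictly weaker" is impossible;
  the only freedom is decomposition.
* §2 THRESHOLD-UNIFORM FORM — for EVERY `M₀ ≥ 0` the crux is equivalent to deriving full `QCD` from
  continuum data restricted to mass tuples above `M₀` (`handover_iff_fromAbove`), and even from the
  conjunction over all thresholds (`handover_iff_fromEventuallyHeavy`).  Reading: whatever the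
  antecedent contributes to a proof must survive deletion of ALL its data below any prescribed
  renormalised mass; light-quark existence, every gap clause and the chirality pin are on the crux's
  side of the arrow.
* §3 MONOID-INVARIANCE MISMATCH — the antecedent's witness predicate is invariant under the up-shifts
  `m_crit(k) ↦ m_crit(k) + a_k M / Z_m(k)`, `M ≥ 0` (`x0Body_shift`), while the conclusion's chirality
  clause is destroyed by any up-shift past a uniformly gapped threshold (landed
  `Negative.not_isChiralAtZero_mcrit_shift_of_uniformGapAbove`): the pin that `QCDOf` demands must be
  located by information the antecedent does not carry.
* §4 The honest decomposition exists and is LANDED (`Split.RobustYangMillsHandover_of_subs`, s1,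
  p140732); it is invoked here by name (an `example`) so this file is checked against it.
-/

namespace Summit.QuantumFields.QCD.Cruxes.RobustYangMillsHandover.CensusS13

open Summit.QuantumFields.QCD.Theses.HeatSlicedQuarks
open Literature.MathematicalPhysics.QuantumFieldTheory
open Summit.QuantumFields.QCD.Theorems.RobustYangMillsHandover

/-! ## §1 Slot minimality -/

/-- Any filler of the route slot implies the crux (currying). [folklore] -/
theorem slot_minimal (C' : Prop) (h : C' → ContinuumQCDExists → _root_.QCD) :
    C' → RobustYangMillsHandover := h

/-- The crux fills its own slot. [folklore] -/
theorem slot_filled : RobustYangMillsHandover → ContinuumQCDExists → _root_.QCD := id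

/-- Hence a filler implied by the crux IS the crux: no strictly weaker re-typing exists. [folklore] -/
theorem filler_iff_crux (C' : Prop) (h : C' → ContinuumQCDExists → _root_.QCD)
    (h' : RobustYangMillsHandover → C') : C' ↔ RobustYangMillsHandover := ⟨h, h'⟩

/-- … and the summit conjunct itself is such a filler (the strongest one). [folklore] -/
theorem qcd_fills : _root_.QCD → ContinuumQCDExists → _root_.QCD := fun h _ => h

/-! ## §2 Threshold-uniform form of the crux -/

/-- The antecedent restricted to mass tuples above `M₀` (in the witness's own renormalised
coordinates). [folklore] -/
def ContinuumQCDExistsAbove (M₀ : ℝ) : Prop :=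
  ∀ Nf : ℕ, Nf = 2 ∨ Nf = 3 → ∃ reg : QCDRegularisation Nf, reg.HasMassScaling ∧
    ∀ m : Fin Nf → ℝ, (∀ f, M₀ < m f) →
      ∃ (z shift : QCDField Nf → ℕ → ℝ) (T : OSData (QCDField Nf) 4),
        IsQCDAlong (reg.scheme m z shift) T ∧ T.IsNontrivial QCDField.glue ∧
          T.IsNonGaussian QCDField.glue ∧
            ∀ f g : Fin Nf, f ≠ g → T.IsNontrivial (QCDField.pseudoRe f g)

/-- At `M₀ = 0` this is the antecedent verbatim. [folklore] -/
theorem continuumQCDExistsAbove_zero : ContinuumQCDExistsAbove 0 ↔ ContinuumQCDExists := Iff.rfl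

/-- Restriction is monotone in the threshold. [folklore] -/
theorem continuumQCDExistsAbove_mono {M₀ M₁ : ℝ} (hle : M₀ ≤ M₁) :
    ContinuumQCDExistsAbove M₀ → ContinuumQCDExistsAbove M₁ := by
  intro h Nf hNf
  obtain ⟨reg, hms, hdata⟩ := h Nf hNf
  exact ⟨reg, hms, fun m hm => hdata m fun f => lt_of_le_of_lt hle (hm f)⟩

/-- **The antecedent is threshold-blind**: for every `M₀ ≥ 0`, X₀ is equivalent to its restriction
above `M₀` (down: restrict; up: shift `m_crit`, landed `Negative.continuumQCDExists_iff_threshold`).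
[folklore] -/
theorem continuumQCDExists_iff_above {M₀ : ℝ} (hM : 0 ≤ M₀) :
    ContinuumQCDExists ↔ ContinuumQCDExistsAbove M₀ := by
  constructor
  · intro h
    exact continuumQCDExistsAbove_mono hM (continuumQCDExistsAbove_zero.mpr h)
  · intro h
    rw [Negative.continuumQCDExists_iff_threshold]
    intro Nf hNf
    obtain ⟨reg, hms, hdata⟩ := h Nf hNf
    exact ⟨M₀, hM, reg, hms, hdata⟩

/-- **The crux, uniformly in the threshold**: for every `M₀ ≥ 0`, `RobustYangMillsHandover` is the
derivation of full `QCD` (chirality pin, light-quark existence, both gap clauses at every positive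
mass) from continuum data for mass tuples above `M₀` only. [folklore] -/
theorem handover_iff_fromAbove {M₀ : ℝ} (hM : 0 ≤ M₀) :
    RobustYangMillsHandover ↔ (ContinuumQCDExistsAbove M₀ → _root_.QCD) :=
  ⟨fun h hx => h ((continuumQCDExists_iff_above hM).mpr hx),
   fun h hx => h ((continuumQCDExists_iff_above hM).mp hx)⟩

/-- The conjunction over ALL thresholds is still the antecedent … [folklore] -/
theorem eventuallyHeavy_iff : (∀ M₀ : ℝ, 0 ≤ M₀ → ContinuumQCDExistsAbove M₀) ↔ ContinuumQCDExists :=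
  ⟨fun h => (continuumQCDExists_iff_above le_rfl).mpr (h 0 le_rfl),
   fun h _ hM => (continuumQCDExists_iff_above hM).mp h⟩

/-- … so the crux is also "QCD from arbitrarily-heavy-only existence". [folklore] -/
theorem handover_iff_fromEventuallyHeavy :
    RobustYangMillsHandover ↔ ((∀ M₀ : ℝ, 0 ≤ M₀ → ContinuumQCDExistsAbove M₀) → _root_.QCD) := by
  rw [eventuallyHeavy_iff]; rfl

/-! ## §3 Monoid-invariance mismatch -/

/-- The antecedent's witness predicate for one flavour number and one regularisation. [folklore] -/
def X0Body (Nf : ℕ) (reg : QCDRegularisation Nf) : Prop :=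
  reg.HasMassScaling ∧ ∀ m : Fin Nf → ℝ, (∀ f, 0 < m f) →
    ∃ (z shift : QCDField Nf → ℕ → ℝ) (T : OSData (QCDField Nf) 4),
      IsQCDAlong (reg.scheme m z shift) T ∧ T.IsNontrivial QCDField.glue ∧
        T.IsNonGaussian QCDField.glue ∧
          ∀ f g : Fin Nf, f ≠ g → T.IsNontrivial (QCDField.pseudoRe f g)

/-- The up-shift of the additive mass renormalisation by a renormalised offset `M`. [folklore] -/
noncomputable def shiftUp {Nf : ℕ} (reg : QCDRegularisation Nf) (M : ℝ) : QCDRegularisation Nf :=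
  { reg with mcrit := fun k => reg.mcrit k + reg.a k * M / reg.Zm k }

/-- The antecedent, spelled through `X0Body`. [folklore] -/
theorem continuumQCDExists_iff_body :
    ContinuumQCDExists ↔ ∀ Nf : ℕ, Nf = 2 ∨ Nf = 3 → ∃ reg : QCDRegularisation Nf, X0Body Nf reg :=
  Iff.rfl

/-- **X₀-witnesses are closed under up-shifts** (`M ≥ 0`): the antecedent cannot distinguish a
witness from any of its up-shifts. [folklore] -/
theorem x0Body_shift {Nf : ℕ} {reg : QCDRegularisation Nf} (h : X0Body Nf reg) {M : ℝ} (hM : 0 ≤ M) :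
    X0Body Nf (shiftUp reg M) := by
  obtain ⟨hms, hdata⟩ := h
  refine ⟨hms, fun m hm => ?_⟩
  obtain ⟨z, shift, T, hQ, hN, hG, hP⟩ := hdata (fun f => M + m f) (fun f => by linarith [hm f])
  refine ⟨z, shift, T, ?_, hN, hG, hP⟩
  show IsQCDAlong ((shiftUp reg M).scheme m z shift) T
  unfold shiftUp
  rwa [Theorems.GluonicCompletion.Negative.scheme_mcrit_shift]

/-- **… whereas the conclusion's chirality clause is up-shift-SENSITIVE** (landed, re-exported by
name): a regularisation uniformly lattice-gapped at rate `ε` above an offset `M₀ ≥ 0` has a NON-chiral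
`M₀`-shift.  So the pin demanded by `QCDOf` is located by lattice information (where the uniform rate
fails) that no X₀-witness carries. [folklore] -/
theorem conclusion_shift_sensitive {Nf : ℕ} (reg : QCDRegularisation Nf) {M₀ ε : ℝ} (hε : 0 < ε)
    (hgap : ∀ m : Fin Nf → ℝ, (∀ f, M₀ < m f) → (reg.scheme m 0 0).HasLatticeMassGap ε) :
    ¬ (shiftUp reg M₀).IsChiralAtZero :=
  Negative.not_isChiralAtZero_mcrit_shift_of_uniformGapAbove reg M₀ hε hgap

/-! ## §4 The landed decomposition, by name -/

/-- The honest three-piece split (s1, p140732), re-exported so this census elaborates against it.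
[folklore] -/
example := @Split.RobustYangMillsHandover_of_subs

end Summit.QuantumFields.QCD.Cruxes.RobustYangMillsHandover.CensusS13
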